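import Mathlib
import HarnessLib
import Summits.HubbardSuperconductivity.HubbardSuperconductivity.Theorems.KLProgrammeKLRegimeSymbolSampledThird

/-!
# Route `KLProgramme` — engine support, route (L2) symbol layer at ORDER THREE: space differences of the sampled symbol when the ZONE hypothesis
# is carried by the symbol itself (periodic band + square cutoff in the angular factor)

Cell `gate-hubbard-kl`, seat p3 (g10); the order-three twin of p4's `…H10TwoPointLimitSymbolProductSampledZone`, companion of
`…KLRegimeSymbolSampledThird` (`norm_fwdDiff_three_space_sampledSymbol_le` puts the zone hypothesis on the band `e`, which a periodic band cannot
meet; here it is put on `Φ`, and the line bounds of `Z` are asked only on the enlarged square in the shell).  For W1 of the (E4)ₙ supply of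
stmt-HubbardSuperconductivity-20437 (located risk «(b)-Wt@j≥1», cure W1-MIXED).

* **`norm_fwdDiff_three_space_sampledSymbol_le'`** — for an integer step `u` (`w = hₓu`, `3|hₓ||u_j| ≤ zm`), if `Φ(k₀, p) = 0` whenever some
  `|p_j| ≥ π − zm`, then for EVERY `q`
  `‖Δ³_{(0,ū)} G̃(q)‖ ≤ [(8g₃+12g₂)τ³/Λ³ + (12g₂+6g₁)τK₂‖w‖²/Λ² + 2g₁K₃‖w‖³/Λ]z₀ + 3[(4g₂+2g₁)τ²/Λ² + 2g₁K₂‖w‖²/Λ]z₁ + 3(2g₁τ/Λ)z₂ + g₀z₃`.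

Everything is proved; no definitions, no named facts. [folklore]  (BGM 2006 Lemma 2.2, (2.53)–(2.55), footnote ¹.)
-/

noncomputable section

namespace Summit.HubbardSuperconductivity.HubbardSuperconductivity.Theorems.TorusFourierL2

set_option linter.dupNamespace false -- summit = problem name (single-conjunct summit), D-0017

open Set Finset Filter Topology Literature.Probability.LatticeModels Literature.Analysis.Calculus
open scoped Real

section Sampled

variable {P L : ℕ} [NeZero P] [NeZero L]

/-! ### Space differences at order three, zone hypothesis on the symbol (the form a PERIODIC band needs) -/

/-- **Space direction, pointwise, order three, for a symbol vanishing near the zone boundary** (the form a PERIODIC band needs): as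
`norm_fwdDiff_three_space_sampledSymbol_le`, but the zone hypothesis is put on `Φ` itself (`Φ(k₀, p) = 0` as soon as some `|p_j| ≥ π − zm`; for a
periodic band this is arranged by the smooth square cutoff inside `Z`), and the line bounds of `Z` are only required at points of the enlarged square
`|p_i| ≤ π + zm` in the shell `{|e| ≤ Λ}` (where the segments through the samples live):
`‖Δ³_{(0,ū)} G̃(q)‖ ≤ [(8g₃+12g₂)τ³/Λ³ + (12g₂+6g₁)τK₂‖w‖²/Λ² + 2g₁K₃‖w‖³/Λ]·z₀ + 3[(4g₂+2g₁)τ²/Λ² + 2g₁K₂‖w‖²/Λ]·z₁ + 3·(2g₁τ/Λ)·z₂ + g₀z₃`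
for EVERY `q`. [cite: BenfattoGiulianiMastropietro2006, §2.5 Lemma 2.2 (2.53)–(2.55)] -/
theorem norm_fwdDiff_three_space_sampledSymbol_le' {G : ℝ → ℝ} (hG : ContDiff ℝ 3 G) {Λ g₀ g₁ g₂ g₃ : ℝ} (hΛ : 0 < Λ)
    (hg₀ : 0 ≤ g₀) (hg₁ : 0 ≤ g₁) (hg₂ : 0 ≤ g₂) (hg₃ : 0 ≤ g₃) (hG0 : ∀ u, |G u| ≤ g₀) (hG1 : ∀ u, |deriv G u| ≤ g₁ / Λ ^ 2)
    (hG2 : ∀ u, |iteratedDeriv 2 G u| ≤ g₂ / Λ ^ 4) (hG3 : ∀ u, |iteratedDeriv 3 G u| ≤ g₃ / Λ ^ 6) (hGv : ∀ u, Λ ^ 2 < u → G u = 0)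
    {e : (Fin 2 → ℝ) → ℝ} (he : ContDiff ℝ 3 e) {K₂ K₃ : ℝ} (hK₂ : ∀ p, ‖iteratedFDeriv ℝ 2 e p‖ ≤ K₂)
    (hK₃ : ∀ p, ‖iteratedFDeriv ℝ 3 e p‖ ≤ K₃) (w : Fin 2 → ℝ) {τ : ℝ} (hτ : ∀ p, |fderiv ℝ e p w| ≤ τ)
    {Z : (Fin 2 → ℝ) → ℝ} (hZ : ContDiff ℝ 3 Z) {z₀ z₁ z₂ z₃ : ℝ} (hz₀ : 0 ≤ z₀) (hz₁ : 0 ≤ z₁) (hz₂ : 0 ≤ z₂) (hz₃ : 0 ≤ z₃)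
    (hZ0 : ∀ p, |Z p| ≤ z₀)
    {zm : ℝ}
    (hZ1 : ∀ (p₀ : Fin 2 → ℝ) (s : ℝ), (∀ i, |(p₀ + s • w) i| ≤ π + zm) → |e (p₀ + s • w)| ≤ Λ →
      |deriv (fun s : ℝ => Z (p₀ + s • w)) s| ≤ z₁)
    (hZ2 : ∀ (p₀ : Fin 2 → ℝ) (s : ℝ), (∀ i, |(p₀ + s • w) i| ≤ π + zm) → |e (p₀ + s • w)| ≤ Λ →
      |iteratedDeriv 2 (fun s : ℝ => Z (p₀ + s • w)) s| ≤ z₂)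
    (hZ3 : ∀ (p₀ : Fin 2 → ℝ) (s : ℝ), (∀ i, |(p₀ + s • w) i| ≤ π + zm) → |e (p₀ + s • w)| ≤ Λ →
      |iteratedDeriv 3 (fun s : ℝ => Z (p₀ + s • w)) s| ≤ z₃)
    (Φ : ℝ × (Fin 2 → ℝ) → ℂ) (hΦ : ∀ k₀ p, Φ (k₀, p) = ((G (k₀ ^ 2 + e p ^ 2) * Z p : ℝ) : ℂ)) (a₀ h₀ hx : ℝ)
    (u : Fin 2 → ℤ) (hw : w = fun j => hx * (u j : ℝ)) (hu : ∀ j, 3 * |hx| * |(u j : ℝ)| ≤ zm)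
    (hzoneΦ : ∀ (k₀ : ℝ) (p : Fin 2 → ℝ), (∃ j, π - zm ≤ |p j|) → Φ (k₀, p) = 0) (hxL : |hx| * L = 2 * π)
    (Gs : TorusSite 1 P × TorusSite 2 L → ℂ)
    (hGs : ∀ q, Gs q = Φ (a₀ + h₀ * (((q.1 0).val : ℕ) : ℝ), fun j => hx * (((q.2 j).valMinAbs : ℤ) : ℝ)))
    (q : TorusSite 1 P × TorusSite 2 L) :
    ‖((fwdDiff ((0 : TorusSite 1 P), (fun j => ((u j : ℤ) : ZMod L))))^[3] Gs) q‖ ≤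
      ((8 * g₃ + 12 * g₂) * τ ^ 3 / Λ ^ 3 + (12 * g₂ + 6 * g₁) * (τ * (K₂ * ‖w‖ ^ 2)) / Λ ^ 2 + 2 * g₁ * (K₃ * ‖w‖ ^ 3) / Λ) * z₀ +
        3 * (((4 * g₂ + 2 * g₁) * τ ^ 2 / Λ ^ 2 + 2 * g₁ * (K₂ * ‖w‖ ^ 2) / Λ) * z₁) + 3 * (2 * g₁ * τ / Λ * z₂) + g₀ * z₃ := by
  have hK0 : 0 ≤ K₂ := le_trans (norm_nonneg _) (hK₂ 0)
  have hK30 : 0 ≤ K₃ := le_trans (norm_nonneg _) (hK₃ 0)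
  have hτ0 : 0 ≤ τ := le_trans (abs_nonneg _) (hτ 0)
  have hRHS : 0 ≤ ((8 * g₃ + 12 * g₂) * τ ^ 3 / Λ ^ 3 + (12 * g₂ + 6 * g₁) * (τ * (K₂ * ‖w‖ ^ 2)) / Λ ^ 2 +
        2 * g₁ * (K₃ * ‖w‖ ^ 3) / Λ) * z₀ +
      3 * (((4 * g₂ + 2 * g₁) * τ ^ 2 / Λ ^ 2 + 2 * g₁ * (K₂ * ‖w‖ ^ 2) / Λ) * z₁) + 3 * (2 * g₁ * τ / Λ * z₂) + g₀ * z₃ := by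
    positivity
  -- the zone: `Φ(k₀, hₓ m) = 0` whenever `2|m_j| + 6|u_j| ≥ L`
  have hL : (0 : ℝ) < L := Nat.cast_pos.2 (Nat.pos_of_ne_zero (NeZero.ne L))
  have hxL' : ∀ (m : Fin 2 → ℤ) (j : Fin 2), (L : ℤ) ≤ 2 * |m j| + 2 * (3 : ℕ) * |u j| → |hx| * L ≤ 2 * π →
      π - zm ≤ |hx * (m j : ℝ)| := by
    intro m j hj hxL
    have hj' : (L : ℝ) ≤ 2 * |(m j : ℝ)| + 6 * |(u j : ℝ)| := by
      have := hj; push_cast at this ⊢; rw [← Int.cast_abs, ← Int.cast_abs]; exact_mod_cast (by linarith : (L:ℤ) ≤ 2*|m j| + 6*|u j|)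
    rw [abs_mul]
    have h1 : |hx| * L ≤ |hx| * (2 * |(m j : ℝ)| + 6 * |(u j : ℝ)|) := mul_le_mul_of_nonneg_left hj' (abs_nonneg _)
    have h2 := hu j
    nlinarith [abs_nonneg hx, abs_nonneg (m j : ℝ)]
  have hzone' : ∀ (k₀ : ℝ) (m : Fin 2 → ℤ), (∃ j, (L : ℤ) ≤ 2 * |m j| + 2 * (3 : ℕ) * |u j|) →
      Φ (k₀, fun j => hx * (m j : ℝ)) = 0 := by
    intro k₀ m ⟨j, hj⟩
    exact hzoneΦ k₀ (fun j => hx * (m j : ℝ)) ⟨j, hxL' m j hj hxL.le⟩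
  -- the sample point and the line
  set k₀ : ℝ := a₀ + h₀ * (((q.1 0).val : ℕ) : ℝ) with hk₀
  set k : Fin 2 → ℝ := fun j => hx * (((q.2 j).valMinAbs : ℤ) : ℝ) with hk
  have hline : (fun s : ℝ => Φ (((k₀, k) : ℝ × (Fin 2 → ℝ)) + s • (((0 : ℝ), w) : ℝ × (Fin 2 → ℝ)))) =
      fun s => (((G (e (k + s • w) ^ 2 + k₀ ^ 2) * Z (k + s • w) : ℝ)) : ℂ) := by
    funext s; rw [spaceLine_apply, hΦ]; push_cast; ring
  have hZl : ContDiff ℝ 3 fun s : ℝ => Z (k + s • w) := hZ.comp (contDiff_const.add (contDiff_id.smul contDiff_const))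
  have hreal : ContDiff ℝ 3 fun s : ℝ => G (e (k + s • w) ^ 2 + k₀ ^ 2) * Z (k + s • w) :=
    contDiff_three_radialComp_mul hG (contDiff_three_line he k w) hZl _
  have hC : ContDiff ℝ 3 fun s : ℝ => Φ (((k₀, k) : ℝ × (Fin 2 → ℝ)) + s • (((0 : ℝ), w) : ℝ × (Fin 2 → ℝ))) := by
    rw [hline]; exact Complex.ofRealCLM.contDiff.comp hreal
  have hstep : (((0 : ℝ), w) : ℝ × (Fin 2 → ℝ)) = ((0 : ℝ), fun j => hx * (u j : ℝ)) := by rw [hw]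
  have hsqr : ∀ s : ℝ, |s| ≤ 3 → ∀ i, |(k + s • w) i| ≤ π + zm := by
    intro s hs3 i
    have h1 : |k i| ≤ π := abs_sample_le_pi hxL q.2 i
    have h2 : |(s • w) i| ≤ zm := by
      rw [Pi.smul_apply, smul_eq_mul, abs_mul, hw]
      calc |s| * |hx * (u i : ℝ)| ≤ 3 * |hx * (u i : ℝ)| := mul_le_mul_of_nonneg_right hs3 (abs_nonneg _)
        _ = 3 * |hx| * |(u i : ℝ)| := by rw [abs_mul]; ring
        _ ≤ zm := hu i
    calc |(k + s • w) i| = |k i + (s • w) i| := rfl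
      _ ≤ |k i| + |(s • w) i| := abs_add_le _ _
      _ ≤ π + zm := add_le_add h1 h2
  have hmain : ∀ s ∈ Set.Icc (0 : ℝ) 3, ‖iteratedDeriv 3 (fun s : ℝ =>
      Φ (((k₀, k) : ℝ × (Fin 2 → ℝ)) + s • (((0 : ℝ), w) : ℝ × (Fin 2 → ℝ)))) s‖ ≤
      ((8 * g₃ + 12 * g₂) * τ ^ 3 / Λ ^ 3 + (12 * g₂ + 6 * g₁) * (τ * (K₂ * ‖w‖ ^ 2)) / Λ ^ 2 + 2 * g₁ * (K₃ * ‖w‖ ^ 3) / Λ) * z₀ +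
        3 * (((4 * g₂ + 2 * g₁) * τ ^ 2 / Λ ^ 2 + 2 * g₁ * (K₂ * ‖w‖ ^ 2) / Λ) * z₁) + 3 * (2 * g₁ * τ / Λ * z₂) + g₀ * z₃ := by
    intro s hs
    have hs3 : |s| ≤ 3 := by rw [abs_of_nonneg hs.1]; exact hs.2
    rw [hline, norm_iteratedDeriv_ofReal_comp hreal]
    by_cases hsupp : Λ ^ 2 < e (k + s • w) ^ 2 + k₀ ^ 2
    · rw [radialComp_mul_deriv3_eq_zero_of_lt hG (contDiff_three_line he k w) hZl hGv (k₀ ^ 2) hsupp, abs_zero]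
      exact hRHS
    · push Not at hsupp
      have hes : |e (k + s • w)| ≤ Λ := abs_le_of_sq_add_le (sq_nonneg k₀) hΛ.le hsupp
      have h := abs_iteratedDeriv_three_symbol_spaceLine_le he hK₂ hK₃ hG hZl hΛ hg₁ hg₂ hg₃ hG0 hG1 hG2 hG3 hGv (sq_nonneg k₀) k w s
      have hdir : |fderiv ℝ e (k + s • w) w| ≤ τ := hτ _
      have hsq : (fderiv ℝ e (k + s • w) w) ^ 2 ≤ τ ^ 2 := by
        rw [← sq_abs]; exact pow_le_pow_left₀ (abs_nonneg _) hdir 2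
      have hcu : |fderiv ℝ e (k + s • w) w| ^ 3 ≤ τ ^ 3 := pow_le_pow_left₀ (abs_nonneg _) hdir 3
      have hZ1s := hZ1 k s (hsqr s hs3) hes
      have hZ2s := hZ2 k s (hsqr s hs3) hes
      have hZ3s := hZ3 k s (hsqr s hs3) hes
      have hZ0s := hZ0 (k + s • w)
      refine h.trans ?_
      gcongr
  rw [hstep] at hC hmain
  exact norm_fwdDiff_iter_space_apply_le Φ a₀ h₀ hx 3 Gs hGs u hzone' q hC hmain

end Sampled

end Summit.HubbardSuperconductivity.HubbardSuperconductivity.Theorems.TorusFourierL2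

end
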